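import Literature.NumberTheory.ModularForms.SiegelHalfSpaceTwoInvariance
import HarnessLib

/-!
# Unfolding over Siegel fundamental domains of `Sp₄(ℤ)` on the Siegel half space of degree 2

Stage 3 of the bottom-up proof of Siegel's volume formula
`Literature.NumberTheory.ModularForms.Siegel1943_vol_F2` (`vol(F₂) = π³/270`; [cite: Klingen1990,
Ch. I §3, closing remark]), on top of `SiegelHalfSpaceTwoInvariance.lean` (the action of
`Sp₄(ℝ)` on `↥U = H₂ ⊂ ℝ⁶`, `toR : Sp₄(ℤ) →* Sp₄(ℝ)`, the invariant symplectic volume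
`siegelVolume`). Everything is PROVED (no named facts); the pattern is that of
`Literature/NumberTheory/Automorphic/FundamentalDomainUnfolding.lean` (the `SL₂(ℤ)` case):

* `instMulActionSp4ZU` — `Sp₄(ℤ)` acts on `↥U` through `toR`, measurably and preserving
  `siegelVolume`; `instNegSp4Z`, `smulVec_toR_neg_one` (`-1` acts trivially), `neg_smul_U`,
  `ne_neg_self_Sp4Z`.
* `IsSiegelFD H F` — a measurable `F ⊆ H₂` met by every `H`-orbit whose self-overlaps under
  `H ≤ Sp₄(ℤ)` come only from `±1` up to a `siegelVolume`-null set (the property Klingen I.3 Thm. 2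
  asserts for Siegel's `F₂` and `Γ₂`).
* `ae_orbit_meets_two`, `tsum_setLIntegral_smul_eq`, `setLIntegral_tsum_smul_eq` —
  **unfolding**: for `-1 ∈ H` and `φ ≥ 0` a.e.-measurable,
  `Σ_{γ ∈ H} ∫_F φ(γ p) dv(p) = ∫_F Σ_{γ ∈ H} φ(γ p) dv(p) = 2 ∫_{H₂} φ dv`.
* `ae_tsum_indicator_smul_eq_one` — for `-1 ∉ H` (e.g. the stabiliser of a primitive vector),
  `Σ_{h ∈ H} 𝟙_F(h p) = 1` for a.e. `p`.

## References

* H. Klingen, *Introductory Lectures on Siegel Modular Forms*, CUP 1990, Ch. I §3 Thm. 2.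
  [Klingen1990]
-/

noncomputable section

namespace Literature.NumberTheory.ModularForms.Sp4Covolume

open Complex Matrix

/-! ### `Sp₄(ℤ)` on `H₂`, Siegel fundamental domains and unfolding -/

section Unfolding

open MeasureTheory Set Filter
open scoped ENNReal

/-- `Sp₄(ℤ)` acts on `H₂` through `toR`. [folklore] -/
instance instMulActionSp4ZU : MulAction Sp4Z U := MulAction.compHom U toR

/-- `γ • p = toR γ • p`. [folklore] -/
theorem sp4Z_smul_eq (γ : Sp4Z) (p : U) : γ • p = toR γ • p := rfl

/-- The action of `Sp₄(ℤ)` on `H₂` is measurable. [folklore] -/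
instance instMeasurableConstSMulSp4ZU : MeasurableConstSMul Sp4Z U :=
  ⟨fun γ => measurable_const_smul (toR γ)⟩

/-- `Sp₄(ℤ)` preserves the symplectic volume. [folklore] -/
instance instSMulInvariantMeasureSp4ZU : SMulInvariantMeasure Sp4Z U siegelVolume :=
  ⟨fun γ _s hs => SMulInvariantMeasure.measure_preimage_smul (c := toR γ) hs⟩

/-- `Sp₄(ℤ)` is countable. [folklore] -/
instance instCountableSp4Z : Countable Sp4Z := by
  have : Countable (Matrix (Fin 2 ⊕ Fin 2) (Fin 2 ⊕ Fin 2) ℤ) :=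
    inferInstanceAs (Countable ((Fin 2 ⊕ Fin 2) → (Fin 2 ⊕ Fin 2) → ℤ))
  infer_instance

/-- Negation on `Sp₄(ℤ)`. [folklore] -/
instance instNegSp4Z : Neg Sp4Z := ⟨fun γ => ⟨-γ.1, SymplecticGroup.neg_mem γ.2⟩⟩

/-- The matrix of `-γ`. [folklore] -/
@[simp] theorem coe_neg_Sp4Z (γ : Sp4Z) :
    ((-γ : Sp4Z) : Matrix (Fin 2 ⊕ Fin 2) (Fin 2 ⊕ Fin 2) ℤ) = -(γ : Matrix _ _ ℤ) := rfl

/-- `(-γ)δ = -(γδ)`. [folklore] -/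
theorem neg_mul_Sp4Z (γ δ : Sp4Z) : (-γ) * δ = -(γ * δ) := by
  apply Subtype.ext; simp

/-- `γ(-δ) = -(γδ)`. [folklore] -/
theorem mul_neg_Sp4Z (γ δ : Sp4Z) : γ * (-δ) = -(γ * δ) := by
  apply Subtype.ext; simp

/-- `-(-γ) = γ`. [folklore] -/
theorem neg_neg_Sp4Z (γ : Sp4Z) : -(-γ) = γ := by
  apply Subtype.ext; simp

/-- `-1 ∈ Sp₄(ℤ)` acts trivially on `H₂`. [folklore] -/
theorem smulVec_toR_neg_one (x : Fin 6 → ℝ) : smulVec (toR (-1)) x = x := by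
  have hA : cA (toR (-1)) = -1 := by
    unfold cA blkA; rw [coe_toR, coe_neg_Sp4Z, OneMemClass.coe_one, ← fromBlocks_one,
      fromBlocks_neg, Matrix.fromBlocks_map, toBlocks_fromBlocks₁₁]
    ext i j; fin_cases i <;> fin_cases j <;> simp
  have hB : cB (toR (-1)) = 0 := by
    unfold cB blkB; rw [coe_toR, coe_neg_Sp4Z, OneMemClass.coe_one, ← fromBlocks_one,
      fromBlocks_neg, Matrix.fromBlocks_map, toBlocks_fromBlocks₁₂]
    ext i j; simp
  have hC : cC (toR (-1)) = 0 := by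
    unfold cC blkC; rw [coe_toR, coe_neg_Sp4Z, OneMemClass.coe_one, ← fromBlocks_one,
      fromBlocks_neg, Matrix.fromBlocks_map, toBlocks_fromBlocks₂₁]
    ext i j; simp
  have hD : cD (toR (-1)) = -1 := by
    unfold cD blkD; rw [coe_toR, coe_neg_Sp4Z, OneMemClass.coe_one, ← fromBlocks_one,
      fromBlocks_neg, Matrix.fromBlocks_map, toBlocks_fromBlocks₂₂]
    ext i j; fin_cases i <;> fin_cases j <;> simp
  have hinv : ((-1 : Matrix (Fin 2) (Fin 2) ℂ))⁻¹ = -1 := Matrix.inv_eq_left_inv (by simp)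
  unfold smulVec smulZ matP matQ
  rw [hA, hB, hC, hD, add_zero, Matrix.zero_mul, zero_add, hinv, Matrix.mul_neg,
    Matrix.mul_one, Matrix.neg_mul, Matrix.one_mul, neg_neg, ofZ_toZ]

/-- `-1` acts trivially on `H₂`. [folklore] -/
theorem neg_one_smul_U (p : U) : (-1 : Sp4Z) • p = p :=
  Subtype.ext (smulVec_toR_neg_one p.1)

/-- `(-γ) • p = γ • p`. [folklore] -/
theorem neg_smul_U (γ : Sp4Z) (p : U) : (-γ) • p = γ • p := by
  have : -γ = γ * (-1) := by apply Subtype.ext; simp [coe_neg_Sp4Z]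
  rw [this, mul_smul, neg_one_smul_U]

/-- `γ ≠ -γ` in `Sp₄(ℤ)`. [folklore] -/
theorem ne_neg_self_Sp4Z (γ : Sp4Z) : γ ≠ -γ := by
  intro h
  have h1 := congrArg (fun δ : Sp4Z => (δ : Matrix (Fin 2 ⊕ Fin 2) (Fin 2 ⊕ Fin 2) ℤ)) h
  simp only [coe_neg_Sp4Z] at h1
  have hdet := SymplecticGroup.det_eq_one γ.2
  have h2 : (γ : Matrix (Fin 2 ⊕ Fin 2) (Fin 2 ⊕ Fin 2) ℤ) = 0 := by
    ext i j
    have := congrFun (congrFun h1 i) j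
    simp only [Matrix.neg_apply] at this
    rw [Matrix.zero_apply]
    linarith
  rw [h2, Matrix.det_zero] at hdet
  exact zero_ne_one hdet

/-- **Siegel fundamental domains** for a subgroup `H ≤ Sp₄(ℤ)` acting on `H₂`: a measurable set
met by every orbit, whose self-overlaps under `H` come only from `±1`, up to a null set
(Klingen I.3 Thm. 2: the images of `F_n` under `Γ_n/{±1}` cover `H_n` without gaps and essential
overlappings). [cite: Klingen1990, Ch. I §3 Thm. 2] -/
structure IsSiegelFD (H : Subgroup Sp4Z) (F : Set U) : Prop where
  measurableSet : MeasurableSet F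
  covers : ∀ p : U, ∃ γ ∈ H, γ • p ∈ F
  ae_unique : ∀ᵐ p ∂siegelVolume, p ∈ F → ∀ γ ∈ H, γ • p ∈ F → γ = 1 ∨ γ = -1

variable {H : Subgroup Sp4Z} {F : Set U}

/-- Transport of `ae_unique` along the orbit: for a.e. `p`, two elements of `H` moving `p` into
`F` differ by `±1`. [folklore] -/
theorem ae_unique_orbit (hF : IsSiegelFD H F) :
    ∀ᵐ p ∂siegelVolume, ∀ γ ∈ H, ∀ γ' ∈ H, γ • p ∈ F → γ' • p ∈ F → γ' = γ ∨ γ' = -γ := by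
  set N : Set U := {p | ¬ (p ∈ F → ∀ δ ∈ H, δ • p ∈ F → δ = 1 ∨ δ = -1)} with hN
  have hN0 : siegelVolume N = 0 := by
    have := hF.ae_unique
    rw [ae_iff] at this
    exact this
  have hbad : {p : U | ¬ ∀ γ ∈ H, ∀ γ' ∈ H, γ • p ∈ F → γ' • p ∈ F → γ' = γ ∨ γ' = -γ} ⊆
      ⋃ γ : Sp4Z, (fun p : U => γ • p) ⁻¹' N := by
    intro p hp
    simp only [Set.mem_setOf_eq, not_forall, exists_prop] at hp
    obtain ⟨γ, hγ, γ', hγ', h1, h2, hne⟩ := hp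
    refine Set.mem_iUnion.2 ⟨γ, ?_⟩
    simp only [Set.mem_preimage, hN, Set.mem_setOf_eq, not_forall, exists_prop]
    refine ⟨h1, γ' * γ⁻¹, H.mul_mem hγ' (H.inv_mem hγ), ?_, ?_⟩
    · rw [mul_smul, inv_smul_smul]; exact h2
    · rw [not_or]
      constructor
      · intro h; apply hne; left
        calc γ' = γ' * γ⁻¹ * γ := by group
          _ = γ := by rw [h, one_mul]
      · intro h; apply hne; right
        calc γ' = γ' * γ⁻¹ * γ := by group
          _ = -γ := by rw [h]; apply Subtype.ext; simp [coe_neg_Sp4Z]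
  rw [ae_iff]
  refine measure_mono_null hbad ?_
  refine (measure_iUnion_null_iff).mpr fun γ => ?_
  rw [MeasureTheory.measure_preimage_smul]
  exact hN0

/-- For a.e. `p`, the elements of `H` moving `p` into `F` are exactly `±γ₀` (when `-1 ∈ H`). [folklore] -/
theorem ae_orbit_meets_two (hneg : (-1 : Sp4Z) ∈ H) (hF : IsSiegelFD H F) :
    ∀ᵐ p ∂siegelVolume, ∃ γ₀ ∈ H, {γ : Sp4Z | γ ∈ H ∧ γ • p ∈ F} = {γ₀, -γ₀} := by
  filter_upwards [ae_unique_orbit hF] with p huniq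
  obtain ⟨γ₀, hγ₀, hγ₀F⟩ := hF.covers p
  refine ⟨γ₀, hγ₀, ?_⟩
  ext γ
  simp only [Set.mem_setOf_eq, Set.mem_insert_iff, Set.mem_singleton_iff]
  constructor
  · rintro ⟨hγ, hγF⟩
    exact huniq γ₀ hγ₀ γ hγ hγ₀F hγF
  · rintro (rfl | rfl)
    · exact ⟨hγ₀, hγ₀F⟩
    · refine ⟨?_, ?_⟩
      · have : -γ₀ = (-1) * γ₀ := by apply Subtype.ext; simp [coe_neg_Sp4Z]
        rw [this]; exact H.mul_mem hneg hγ₀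
      · rw [neg_smul_U]; exact hγ₀F

/-- For a.e. `p`, `{γ ∈ H : γ⁻¹ p ∈ F}` is a two-element set. [folklore] -/
theorem ae_inv_smul_mem_iff_finset (hneg : (-1 : Sp4Z) ∈ H) (hF : IsSiegelFD H F) :
    ∀ᵐ p ∂siegelVolume, ∃ S : Finset H, S.card = 2 ∧ ∀ γ : H, ((γ : Sp4Z)⁻¹ • p ∈ F ↔ γ ∈ S) := by
  filter_upwards [ae_orbit_meets_two hneg hF] with p hp
  obtain ⟨γ₀, hγ₀, hset⟩ := hp
  have hγ₀' : γ₀⁻¹ ∈ H := H.inv_mem hγ₀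
  have hnγ₀ : -γ₀ ∈ H := by
    have : -γ₀ = (-1) * γ₀ := by apply Subtype.ext; simp [coe_neg_Sp4Z]
    rw [this]; exact H.mul_mem hneg hγ₀
  have hnγ₀' : (-γ₀)⁻¹ ∈ H := H.inv_mem hnγ₀
  set a : H := ⟨γ₀⁻¹, hγ₀'⟩
  set b : H := ⟨(-γ₀)⁻¹, hnγ₀'⟩
  have hab : a ≠ b := by
    intro h
    have : γ₀⁻¹ = (-γ₀)⁻¹ := congrArg Subtype.val h
    exact ne_neg_self_Sp4Z γ₀ (inv_injective this)
  classical
  refine ⟨{a, b}, Finset.card_pair hab, fun γ => ?_⟩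
  have h1 : ((γ : Sp4Z)⁻¹ ∈ H ∧ (γ : Sp4Z)⁻¹ • p ∈ F) ↔
      ((γ : Sp4Z)⁻¹ = γ₀ ∨ (γ : Sp4Z)⁻¹ = -γ₀) := by
    have := Set.ext_iff.mp hset (γ : Sp4Z)⁻¹
    simpa using this
  rw [Finset.mem_insert, Finset.mem_singleton]
  constructor
  · intro h
    rcases h1.mp ⟨H.inv_mem γ.2, h⟩ with h2 | h2
    · left; apply Subtype.ext; show (γ : Sp4Z) = γ₀⁻¹; rw [← h2, inv_inv]
    · right; apply Subtype.ext; show (γ : Sp4Z) = (-γ₀)⁻¹; rw [← h2, inv_inv]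
  · rintro (rfl | rfl)
    · exact (h1.mpr (Or.inl (by simp [a]))).2
    · exact (h1.mpr (Or.inr (by simp [b]))).2

/-- `Σ_{γ ∈ H} c · 𝟙_F(γ⁻¹ p) = 2c` a.e. [folklore] -/
theorem ae_tsum_indicator_inv_smul (hneg : (-1 : Sp4Z) ∈ H) (hF : IsSiegelFD H F)
    {M : Type*} [AddCommMonoid M] [TopologicalSpace M] [T2Space M] (c : M) :
    ∀ᵐ p ∂siegelVolume, (∑' γ : H, F.indicator (fun _ => c) ((γ : Sp4Z)⁻¹ • p)) = c + c := by
  filter_upwards [ae_inv_smul_mem_iff_finset hneg hF] with p hp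
  obtain ⟨S, hS2, hmem⟩ := hp
  have hsupp : ∀ γ : H, γ ∉ S → F.indicator (fun _ => c) ((γ : Sp4Z)⁻¹ • p) = 0 := by
    intro γ hγ
    rw [Set.indicator_of_notMem]
    exact fun h => hγ ((hmem γ).mp h)
  rw [tsum_eq_sum hsupp]
  have e : ∀ γ ∈ S, F.indicator (fun _ => c) ((γ : Sp4Z)⁻¹ • p) = c := fun γ hγ =>
    Set.indicator_of_mem ((hmem γ).mpr hγ) _
  rw [Finset.sum_congr rfl e, Finset.sum_const, hS2, two_nsmul]

/-- The change of variables `p ↦ γ⁻¹ p` in the symplectic volume: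
`∫_F φ(γ p) dv(p) = ∫ 𝟙_F(γ⁻¹ p) φ(p) dv(p)`. [folklore] -/
theorem setLIntegral_smul_eq_lintegral (hFm : MeasurableSet F) (γ : Sp4Z) (φ : U → ℝ≥0∞) :
    ∫⁻ p in F, φ (γ • p) ∂siegelVolume =
      ∫⁻ p, F.indicator (fun _ => (1 : ℝ≥0∞)) (γ⁻¹ • p) * φ p ∂siegelVolume := by
  rw [← lintegral_indicator hFm]
  have e : F.indicator (fun p => φ (γ • p)) =
      fun p => F.indicator (fun _ => (1 : ℝ≥0∞)) (γ⁻¹ • (γ • p)) * φ (γ • p) := by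
    funext p
    rw [inv_smul_smul]
    by_cases hp : p ∈ F
    · rw [Set.indicator_of_mem hp, Set.indicator_of_mem hp, one_mul]
    · rw [Set.indicator_of_notMem hp, Set.indicator_of_notMem hp, zero_mul]
  rw [e]
  exact (measurePreserving_smul γ siegelVolume).lintegral_comp_emb
    (MeasurableEquiv.smul γ).measurableEmbedding
    (fun q => F.indicator (fun _ => (1 : ℝ≥0∞)) (γ⁻¹ • q) * φ q)

/-- `p ↦ 𝟙_F(γ⁻¹ p)` is measurable. [folklore] -/
theorem measurable_indicator_inv_smul (hFm : MeasurableSet F) (γ : Sp4Z) :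
    Measurable fun p : U => F.indicator (fun _ => (1 : ℝ≥0∞)) (γ⁻¹ • p) :=
  (measurable_const.indicator hFm).comp (measurable_const_smul γ⁻¹)

/-- Translates of a.e.-measurable functions are a.e.-measurable. [folklore] -/
theorem aemeasurable_comp_smul {φ : U → ℝ≥0∞} (hφ : AEMeasurable φ siegelVolume) (γ : Sp4Z) :
    AEMeasurable (fun p : U => φ (γ • p)) siegelVolume :=
  (measurePreserving_smul γ siegelVolume).aemeasurable_comp_iff
    (MeasurableEquiv.smul γ).measurableEmbedding |>.mpr hφ

/-- **Unfolding** over a Siegel fundamental domain of `H ∋ -1`: for a.e.-measurable `φ ≥ 0`,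
`Σ_{γ ∈ H} ∫_F φ(γ p) dv(p) = 2 ∫ φ dv` (the translates `γF`, `γ ∈ H/±1`, tile `H₂` up to a null
set, each counted twice). [cite: Klingen1990, Ch. I §3 Thm. 2] -/
theorem tsum_setLIntegral_smul_eq (hneg : (-1 : Sp4Z) ∈ H) (hF : IsSiegelFD H F)
    {φ : U → ℝ≥0∞} (hφ : AEMeasurable φ siegelVolume) :
    ∑' γ : H, ∫⁻ p in F, φ ((γ : Sp4Z) • p) ∂siegelVolume = 2 * ∫⁻ p, φ p ∂siegelVolume := by
  simp_rw [setLIntegral_smul_eq_lintegral hF.measurableSet]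
  have hmeas : ∀ γ : H, AEMeasurable
      (fun p : U => F.indicator (fun _ => (1 : ℝ≥0∞)) ((γ : Sp4Z)⁻¹ • p) * φ p) siegelVolume :=
    fun γ => AEMeasurable.mul (measurable_indicator_inv_smul hF.measurableSet _).aemeasurable hφ
  rw [← lintegral_tsum hmeas]
  simp_rw [ENNReal.tsum_mul_right]
  rw [← lintegral_const_mul' 2 _ (by norm_num)]
  refine lintegral_congr_ae ?_
  filter_upwards [ae_tsum_indicator_inv_smul hneg hF (1 : ℝ≥0∞)] with p hp
  rw [hp, one_add_one_eq_two]

/-- **Unfolding, swapped form**: `∫_F Σ_{γ ∈ H} φ(γ p) dv(p) = 2 ∫ φ dv`. [folklore] -/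
theorem setLIntegral_tsum_smul_eq (hneg : (-1 : Sp4Z) ∈ H) (hF : IsSiegelFD H F)
    {φ : U → ℝ≥0∞} (hφ : AEMeasurable φ siegelVolume) :
    ∫⁻ p in F, ∑' γ : H, φ ((γ : Sp4Z) • p) ∂siegelVolume = 2 * ∫⁻ p, φ p ∂siegelVolume := by
  rw [lintegral_tsum fun γ => (aemeasurable_comp_smul hφ _).restrict]
  exact tsum_setLIntegral_smul_eq hneg hF hφ

/-- **Exact fundamental domains** (`-1 ∉ H`): for a.e. `p`, exactly one `h ∈ H` has `h p ∈ F`, so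
`Σ_{h ∈ H} 𝟙_F(h p) = 1` a.e. [folklore] -/
theorem ae_tsum_indicator_smul_eq_one (hneg : (-1 : Sp4Z) ∉ H) (hF : IsSiegelFD H F) :
    ∀ᵐ p ∂siegelVolume, (∑' γ : H, F.indicator (fun _ => (1 : ℝ≥0∞)) ((γ : Sp4Z) • p)) = 1 := by
  filter_upwards [ae_unique_orbit hF] with p huniq
  obtain ⟨γ₀, hγ₀, hγ₀F⟩ := hF.covers p
  have hone : ∀ γ : H, (γ : Sp4Z) • p ∈ F ↔ γ = ⟨γ₀, hγ₀⟩ := by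
    intro γ
    constructor
    · intro h
      rcases huniq γ₀ hγ₀ γ γ.2 hγ₀F h with h1 | h1
      · exact Subtype.ext h1
      · exfalso; apply hneg
        have : (-1 : Sp4Z) = (γ : Sp4Z) * γ₀⁻¹ := by
          rw [h1, neg_mul_Sp4Z, mul_inv_cancel]
        rw [this]; exact H.mul_mem γ.2 (H.inv_mem hγ₀)
    · rintro rfl; exact hγ₀F
  classical
  rw [tsum_eq_single ⟨γ₀, hγ₀⟩]
  · rw [Set.indicator_of_mem hγ₀F]
  · intro γ hγ
    rw [Set.indicator_of_notMem]
    exact fun h => hγ ((hone γ).1 h)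

end Unfolding

end Literature.NumberTheory.ModularForms.Sp4Covolume
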